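import Summits.Ventures.PercRepro.C026Residual

/-!
# Lemma D: the `c`-isolation targets of a residual configuration are always free (p5, gen 7)

mine-3's `proofs/MINE3-Q3-proof.md` §4 / §11 S3.  For `S ∈ KL` and an edge `e` between `K = Com_a(S)`
and `M ∖ {c}` (such an edge exists: the K–L walk of the H-graph leaves `K` through one —
`exists_km_edge_of_kl`), put `S′ := (S ∖ E_c) ∪ {e}`:

* `closeAt c S` (every edge at `c` closed), `Kc` (`bot`, not bad, first offer);
* in `S′`, `c` is isolated (`cluster_kmConfig_c`), `L` is unchanged (`cluster_kmConfig_b`), `a ≁ b`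
  (`isBot_kmConfig`); `a` reaches a neighbour of `c` inside `K′` (`exists_nbr_conn_kmConfig`), so
  `S′` has the first offer (`o1_kmConfig`); no H-walk of `S′` from `a` enters `L` (`not_badM_kmConfig`):
  **`kc_kmConfig : Kc S′`**;
* **`kSwapSealed_kmConfig`**: `τ₅₀(S′) = S ∪ E_c ∪ {e}`; **`freeAC_target_of_kl`**: that target is in
  `ac|b` and is not the `τ₅₀`-image of any `BotM ∧ O1` configuration (τ₅₀ is injective and `S′ ∉ BotM`)
  — every residual configuration has an explicit free target (LEMMA D).
-/

namespace PercRepro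

namespace MultiGraph

section LemmaD

variable {V E : Type*} (G : MultiGraph V E)

open Classical in
/-- `S ∖ E_c`: every edge at `c` closed. -/
noncomputable def closeAt (c : V) (ω : Config E) : Config E :=
  fun e => if e ∈ G.edgesAt ({c} : Set V) then false else ω e

/-- `closeAt` on an edge at `c`. -/
theorem closeAt_apply_of_mem {c : V} {ω : Config E} {e : E} (he : e ∈ G.edgesAt ({c} : Set V)) :
    G.closeAt c ω e = false := by
  simp [closeAt, he]

/-- `closeAt` away from `c`. -/
theorem closeAt_apply_of_notMem {c : V} {ω : Config E} {e : E} (he : e ∉ G.edgesAt ({c} : Set V)) :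
    G.closeAt c ω e = ω e := by
  simp [closeAt, he]

/-- `closeAt c ω ≤ ω`. -/
theorem closeAt_le (c : V) (ω : Config E) : G.closeAt c ω ≤ ω := by
  intro e
  by_cases he : e ∈ G.edgesAt ({c} : Set V)
  · rw [G.closeAt_apply_of_mem he]
    exact Bool.false_le _
  · rw [G.closeAt_apply_of_notMem he]

/-- **`Kc`**: `bot`, not bad, with the first offer (mine-3's type `Kc`). -/
def Kc (ω : Config E) (a b c : V) : Prop := G.IsBot ω a b c ∧ ¬ G.BadM ω a b c ∧ G.O1 ω a b c

/-- **An edge between `K` and `M ∖ {c}` exists for `S ∈ KL`**: the K–L walk of the H-graph leaves `K`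
through such an edge. -/
theorem exists_km_edge_of_kl {S : Config E} {a b c : V} (h : G.KL S a b c) :
    ∃ (e : E) (k y : V), G.Joins e k y ∧ k ∈ G.cluster S a ∧ y ∈ G.cluster S c ∧ y ≠ c := by
  have hw : G.HConn S c a b := (G.conn_kSwap_iff_hConn S c a b).mp h.1.2
  have hbK : b ∉ G.cluster S a := fun hb => h.1.1.1 hb
  have hKM : ∀ x ∈ G.cluster S a, x ∉ G.cluster S c :=
    fun x hx hxM => h.1.1.2.1 ((hx : G.Conn S a x).trans (hxM : G.Conn S c x).symm)
  unfold HConn at hw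
  suffices key : ∀ x, Relation.ReflTransGen (G.HAdj S c) x b → x ∈ G.cluster S a →
      ∃ (e : E) (k y : V), G.Joins e k y ∧ k ∈ G.cluster S a ∧ y ∈ G.cluster S c ∧ y ≠ c from
    key a hw (G.self_mem_cluster S a)
  intro x hxb
  induction hxb using Relation.ReflTransGen.head_induction_on with
  | refl => exact fun hb => absurd hb hbK
  | @head x y hxy _ ih =>
    intro hxK
    by_cases hyK : y ∈ G.cluster S a
    · exact ih hyK
    · -- the step `x → y` leaves `K`: it is an edge from `K` into `M`
      rcases hxy with ⟨hxM, _, _⟩ | ⟨hiff, e, hj⟩ | ⟨_, _, hconn⟩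
      · exact absurd hxM (hKM x hxK)
      · have hxM : x ∉ G.cluster S c := hKM x hxK
        have hyM : y ∈ G.cluster S c := by
          by_contra hyM
          exact hxM (hiff.mpr hyM)
        refine ⟨e, x, y, hj, hxK, hyM, fun hyc => ?_⟩
        subst hyc
        exact G.not_joins_c_of_kl h (G.joins_symm hj) (Or.inl hxK)
      · exact absurd ((hxK : G.Conn S a x).trans hconn) hyK

/-! ### The configuration `S′ = (S ∖ E_c) ∪ {e}` -/

variable [DecidableEq E]

/-- `S′ = (S ∖ E_c) ∪ {e}`. -/
noncomputable def kmConfig (c : V) (S : Config E) (e : E) : Config E :=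
  Function.update (G.closeAt c S) e true

/-- The added edge is open in `S′`. -/
theorem kmConfig_apply_self (c : V) (S : Config E) (e : E) : G.kmConfig c S e e = true := by
  simp [kmConfig]

/-- `S′` on another edge. -/
theorem kmConfig_apply_of_ne {c : V} {S : Config E} {e e' : E} (h : e' ≠ e) :
    G.kmConfig c S e e' = G.closeAt c S e' := by
  simp [kmConfig, Function.update_of_ne h]

/-- `closeAt c S ≤ S′`. -/
theorem closeAt_le_kmConfig (c : V) (S : Config E) (e : E) : G.closeAt c S ≤ G.kmConfig c S e :=
  le_update_true _ e

omit [DecidableEq E] in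
/-- A K–M edge is not at `c` (its ends are in `K` and in `M ∖ {c}`). -/
theorem km_not_mem_edgesAt_c {S : Config E} {a b c : V} (h : G.KL S a b c) {e : E} {k y : V}
    (hj : G.Joins e k y) (hk : k ∈ G.cluster S a) (hyc : y ≠ c) : e ∉ G.edgesAt ({c} : Set V) := by
  have hkc : k ≠ c := fun hkc => h.1.1.2.1 (hkc ▸ hk)
  exact G.not_mem_edgesAt_c_of_joins hj hkc hyc

omit [DecidableEq E] in
/-- A K–M edge is not at `L`. -/
theorem km_not_mem_edgesAt_L {S : Config E} {a b c : V} (h : G.KL S a b c) {e : E} {k y : V}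
    (hj : G.Joins e k y) (hk : k ∈ G.cluster S a) (hy : y ∈ G.cluster S c) :
    e ∉ G.edgesAt (G.cluster S b) := by
  intro hL
  rcases G.mem_or_mem_of_mem_edgesAt_of_joins hj hL with hkL | hyL
  · exact h.1.1.1 ((hk : G.Conn S a k).trans (hkL : G.Conn S b k).symm)
  · exact h.1.1.2.2 ((hyL : G.Conn S b y).trans (hy : G.Conn S c y).symm)

/-- In `S′` every edge at `c` is closed. -/
theorem kmConfig_apply_of_mem_c {S : Config E} {a b c : V} (h : G.KL S a b c) {e : E} {k y : V}
    (hj : G.Joins e k y) (hk : k ∈ G.cluster S a) (hyc : y ≠ c) {e' : E}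
    (he' : e' ∈ G.edgesAt ({c} : Set V)) : G.kmConfig c S e e' = false := by
  have hne : e' ≠ e := fun hee => (G.km_not_mem_edgesAt_c h hj hk hyc) (hee ▸ he')
  rw [G.kmConfig_apply_of_ne hne, G.closeAt_apply_of_mem he']

/-- **`c` is isolated in `S′`**. -/
theorem cluster_kmConfig_c {S : Config E} {a b c : V} (h : G.KL S a b c) {e : E} {k y : V}
    (hj : G.Joins e k y) (hk : k ∈ G.cluster S a) (hyc : y ≠ c) :
    G.cluster (G.kmConfig c S e) c = {c} := by
  ext v
  simp only [mem_cluster, Set.mem_singleton_iff]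
  constructor
  · intro hv
    exact eq_of_conn_of_isolated (fun e' he' => by
      by_contra hcon
      apply absurd he'
      rw [G.kmConfig_apply_of_mem_c h hj hk hyc]
      · decide
      · simp only [edgesAt, Set.mem_setOf_eq, Set.mem_singleton_iff]
        tauto) hv
  · rintro rfl
    exact Conn.refl G _ _

/-- **`L` is unchanged in `S′`**. -/
theorem cluster_kmConfig_b {S : Config E} {a b c : V} (h : G.KL S a b c) {e : E} {k y : V}
    (hj : G.Joins e k y) (hk : k ∈ G.cluster S a) (hy : y ∈ G.cluster S c) :
    G.cluster (G.kmConfig c S e) b = G.cluster S b := by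
  refine cluster_eq_of_agree fun e' he' => ?_
  have hne : e' ≠ e := fun hee => (G.km_not_mem_edgesAt_L h hj hk hy) (hee ▸ he')
  rw [G.kmConfig_apply_of_ne hne,
    G.closeAt_apply_of_notMem (G.not_mem_edgesAt_c_of_mem_edgesAt_cluster_b h he')]

/-- `S′ ∈ bot`. -/
theorem isBot_kmConfig {S : Config E} {a b c : V} (h : G.KL S a b c) {e : E} {k y : V}
    (hj : G.Joins e k y) (hk : k ∈ G.cluster S a) (hy : y ∈ G.cluster S c) (hyc : y ≠ c) :
    G.IsBot (G.kmConfig c S e) a b c := by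
  have hc := G.cluster_kmConfig_c h hj hk hyc
  have hL := G.cluster_kmConfig_b h hj hk hy
  have hac : a ≠ c := fun hac => h.1.1.2.1 (hac ▸ Conn.refl G S a)
  have hbc : b ≠ c := fun hbc => h.1.1.2.2 (hbc ▸ Conn.refl G S b)
  refine ⟨fun hab => ?_, fun hac' => ?_, fun hbc' => ?_⟩
  · have : a ∈ G.cluster (G.kmConfig c S e) b := hab.symm
    rw [hL] at this
    exact h.1.1.1 (this : G.Conn S b a).symm
  · have : a ∈ G.cluster (G.kmConfig c S e) c := hac'.symm
    rw [hc] at this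
    exact hac this
  · have : b ∈ G.cluster (G.kmConfig c S e) c := hbc'.symm
    rw [hc] at this
    exact hbc this

/-- The cluster of `a` in `S` survives in `S′` (its edges are not at `c`, and `closeAt c S ≤ S′`). -/
theorem conn_kmConfig_of_conn_a {S : Config E} {a b c : V} (h : G.KL S a b c) (e : E) {v : V}
    (hv : G.Conn S a v) : G.Conn (G.kmConfig c S e) a v := by
  refine conn_of_open_edges (fun e' he' hK => ?_) hv
  have h1 : G.closeAt c S e' = true := by
    rw [G.closeAt_apply_of_notMem (G.not_mem_edgesAt_c_of_mem_edgesAt_cluster_a h hK)]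
    exact he'
  exact (G.closeAt_le_kmConfig c S e e').trans' h1.ge |> fun h2 => by
    have := G.closeAt_le_kmConfig c S e e'
    rw [h1] at this
    exact Bool.eq_true_of_true_le this

omit [DecidableEq E] in
/-- **A neighbour of `c` inside `M ∖ {c}` is `(S ∖ E_c)`-connected to any `y ∈ M ∖ {c}`**: walk
the open path from `c` to `y` and cut its first edge. -/
theorem exists_nbr_of_mem_cluster_c {S : Config E} {c y : V} (hy : y ∈ G.cluster S c) (hyc : y ≠ c) :
    ∃ x, (∃ e', G.Joins e' c x) ∧ G.Conn (G.closeAt c S) x y := by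
  suffices key : y = c ∨ ∃ x, (∃ e', G.Joins e' c x) ∧ G.Conn (G.closeAt c S) x y by
    rcases key with h | h
    · exact absurd h hyc
    · exact h
  refine Conn.induction (motive := fun w => w = c ∨ ∃ x, (∃ e', G.Joins e' c x) ∧ G.Conn (G.closeAt c S) x w)
    (Or.inl rfl) ?_ hy
  intro u w _ huw ih
  obtain ⟨e', he', hend⟩ := huw
  by_cases hec : e' ∈ G.edgesAt ({c} : Set V)
  · simp only [edgesAt, Set.mem_setOf_eq, Set.mem_singleton_iff] at hec
    rcases hec with hec | hec <;> rcases hend with ⟨h1, h2⟩ | ⟨h1, h2⟩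
    · exact Or.inr ⟨w, ⟨e', Or.inl ⟨hec, h2⟩⟩, Conn.refl G _ w⟩
    · exact Or.inl (by rw [← h1, hec])
    · exact Or.inl (by rw [← h2, hec])
    · exact Or.inr ⟨w, ⟨e', Or.inr ⟨h1, hec⟩⟩, Conn.refl G _ w⟩
  · have hopen : G.closeAt c S e' = true := by
      rw [G.closeAt_apply_of_notMem hec]
      exact he'
    have hstep : G.Conn (G.closeAt c S) u w := Conn.of_openAdj ⟨e', hopen, hend⟩
    rcases ih with rfl | ⟨x, hx, hxu⟩
    · exfalso
      apply hec
      rcases hend with ⟨h1, _⟩ | ⟨_, h2⟩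
      · exact Or.inl (by rw [h1]; rfl)
      · exact Or.inr (by rw [h2]; rfl)
    · exact Or.inr ⟨x, hx, hxu.trans hstep⟩

/-- **`a` reaches a neighbour of `c` in `S′`**: `a ~ k` inside `K`, `k ~ y` through `e`, `y ~ x` inside
`M ∖ {c}`. -/
theorem exists_nbr_conn_kmConfig {S : Config E} {a b c : V} (h : G.KL S a b c) {e : E} {k y : V}
    (hj : G.Joins e k y) (hk : k ∈ G.cluster S a) (hy : y ∈ G.cluster S c) (hyc : y ≠ c) :
    ∃ x, (∃ e', G.Joins e' c x) ∧ G.Conn (G.kmConfig c S e) a x := by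
  obtain ⟨x, hx, hxy⟩ := G.exists_nbr_of_mem_cluster_c hy hyc
  refine ⟨x, hx, ?_⟩
  have h1 : G.Conn (G.kmConfig c S e) a k := G.conn_kmConfig_of_conn_a h e hk
  have h2 : G.Conn (G.kmConfig c S e) k y := Conn.of_openAdj ⟨e, G.kmConfig_apply_self c S e, hj⟩
  have h3 : G.Conn (G.kmConfig c S e) y x := (Conn.mono (G.closeAt_le_kmConfig c S e) hxy).symm
  exact (h1.trans h2).trans h3

/-- **`S′` has the first offer** (`O1`). -/
theorem o1_kmConfig {S : Config E} {a b c : V} (h : G.KL S a b c) {e : E} {k y : V}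
    (hj : G.Joins e k y) (hk : k ∈ G.cluster S a) (hy : y ∈ G.cluster S c) (hyc : y ≠ c) :
    G.O1 (G.kmConfig c S e) a b c := by
  have hbot := G.isBot_kmConfig h hj hk hy hyc
  refine ⟨hbot, (G.cellAC_kSwapSealed_iff hbot).mpr ?_⟩
  obtain ⟨x, ⟨e', hj'⟩, hax⟩ := G.exists_nbr_conn_kmConfig h hj hk hy hyc
  have hc := G.cluster_kmConfig_c h hj hk hyc
  have hL := G.cluster_kmConfig_b h hj hk hy
  have hxc : x ≠ c := by
    rintro rfl
    -- `x = c`: then `a ~ c` in `S′`, contradicting `bot`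
    exact hbot.2.1 hax
  have hxM : x ∉ G.cluster (G.kmConfig c S e) c := by
    rw [hc]
    exact hxc
  have haM : a ∉ G.cluster (G.kmConfig c S e) c := by
    rw [hc]
    exact fun hac => hbot.2.1 (hac ▸ Conn.refl G _ a)
  have hcM : c ∈ G.cluster (G.kmConfig c S e) c := G.self_mem_cluster _ c
  have hcL : c ∉ G.cluster (G.kmConfig c S e) b := fun hcL => hbot.2.2 hcL
  have haL : a ∉ G.cluster (G.kmConfig c S e) b := fun haL => hbot.1 (haL : G.Conn _ b a).symm
  have hxL : x ∉ G.cluster (G.kmConfig c S e) b :=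
    fun hxL => hbot.1 (hax.trans (hxL : G.Conn _ b x).symm)
  -- the H-walk `c → x → a` in `S′`, avoiding `L`
  have step1 : G.HAdj (G.kmConfig c S e) c c x :=
    Or.inr (Or.inl ⟨⟨fun _ => hxM, fun _ => hcM⟩, e', hj'⟩)
  have step2 : G.HAdj (G.kmConfig c S e) c x a := Or.inr (Or.inr ⟨hxM, haM, hax.symm⟩)
  exact (Relation.ReflTransGen.single ⟨step1, hcL, hxL⟩).tail ⟨step2, hxL, haL⟩

/-- **`S′` is not bad**: no H-walk of `S′` from `a` enters `L` (inside clusters one stays out of `L`;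
through `c` one only reaches neighbours of `c`, none of which is in `L`). -/
theorem not_badM_kmConfig {S : Config E} {a b c : V} (h : G.KL S a b c) {e : E} {k y : V}
    (hj : G.Joins e k y) (hk : k ∈ G.cluster S a) (hy : y ∈ G.cluster S c) (hyc : y ≠ c) :
    ¬ G.BadM (G.kmConfig c S e) a b c := by
  rintro ⟨_, hw⟩
  rw [G.conn_kSwap_iff_hConn] at hw
  have hL := G.cluster_kmConfig_b h hj hk hy
  have hc := G.cluster_kmConfig_c h hj hk hyc
  have hbot := G.isBot_kmConfig h hj hk hy hyc
  -- every vertex of the walk is outside `L`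
  have key : ∀ v, G.HConn (G.kmConfig c S e) c a v → v ∉ G.cluster (G.kmConfig c S e) b := by
    intro v hv
    unfold HConn at hv
    induction hv with
    | refl => exact fun haL => hbot.1 (haL : G.Conn _ b a).symm
    | @tail u v _ huv ih =>
      rcases huv with ⟨_, hvM, _⟩ | ⟨hiff, e', hj'⟩ | ⟨_, _, hconn⟩
      · rw [hc] at hvM
        rw [hvM]
        exact fun hcL => hbot.2.2 hcL
      · -- an edge between `c` and `V ∖ {c}`: the other end is a neighbour of `c`, hence not in `L`
        intro hvL
        rw [hL] at hvL
        by_cases huc : u = c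
        · subst huc
          exact G.not_joins_c_of_kl h hj' (Or.inr hvL)
        · have huM : u ∉ G.cluster (G.kmConfig c S e) c := by
            rw [hc]
            exact huc
          have hvM : v ∈ G.cluster (G.kmConfig c S e) c := by
            by_contra hvM
            exact huM (hiff.mpr hvM)
          rw [hc] at hvM
          rw [hvM] at hvL
          exact h.1.1.2.2 hvL
      · intro hvL
        exact ih ((hvL : G.Conn _ b v).trans hconn.symm)
  exact key b hw (G.self_mem_cluster _ b)

/-- **`S′ ∈ Kc`** (Lemma D, first part). -/
theorem kc_kmConfig {S : Config E} {a b c : V} (h : G.KL S a b c) {e : E} {k y : V}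
    (hj : G.Joins e k y) (hk : k ∈ G.cluster S a) (hy : y ∈ G.cluster S c) (hyc : y ≠ c) :
    G.Kc (G.kmConfig c S e) a b c :=
  ⟨G.isBot_kmConfig h hj hk hy hyc, G.not_badM_kmConfig h hj hk hy hyc, G.o1_kmConfig h hj hk hy hyc⟩

/-- **`τ₅₀(S′) = S ∪ E_c ∪ {e}`** (Lemma D, the image formula). -/
theorem kSwapSealed_kmConfig {S : Config E} {a b c : V} (h : G.KL S a b c) {e : E} {k y : V}
    (hj : G.Joins e k y) (hk : k ∈ G.cluster S a) (hy : y ∈ G.cluster S c) (hyc : y ≠ c) :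
    G.kSwapSealed c b (G.kmConfig c S e) = G.openAt c (Function.update S e true) := by
  have hc := G.cluster_kmConfig_c h hj hk hyc
  have hL := G.cluster_kmConfig_b h hj hk hy
  funext e'
  by_cases hec : e' ∈ G.edgesAt ({c} : Set V)
  · -- at `c`: closed in `S′`, not at `L`, flipped open
    have hnotL : e' ∉ G.edgesAt (G.cluster (G.kmConfig c S e) b) := by
      rw [hL]
      exact fun hL' => G.not_mem_edgesAt_c_of_mem_edgesAt_cluster_b h hL' hec
    have hM : e' ∈ G.edgesAt (G.cluster (G.kmConfig c S e) c) := by rw [hc]; exact hec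
    rw [G.kSwapSealed_apply_of_flip hM hnotL, G.kmConfig_apply_of_mem_c h hj hk hyc hec,
      G.openAt_apply_of_mem hec]
    rfl
  · -- away from `c`: not at `{c}`, unchanged by the flip
    have hM : e' ∉ G.edgesAt (G.cluster (G.kmConfig c S e) c) := by rw [hc]; exact hec
    rw [G.kSwapSealed_apply_of_notMem hM, G.openAt_apply_of_notMem hec]
    by_cases hee : e' = e
    · subst hee
      rw [G.kmConfig_apply_self, Function.update_self]
    · rw [G.kmConfig_apply_of_ne hee, G.closeAt_apply_of_notMem hec, Function.update_of_ne hee]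

/-- **LEMMA D**: for `S ∈ KL` and a K–M edge `e`, `S ∪ E_c ∪ {e}` is a free `ac|b` target. -/
theorem freeAC_target_of_kl {S : Config E} {a b c : V} (h : G.KL S a b c) {e : E} {k y : V}
    (hj : G.Joins e k y) (hk : k ∈ G.cluster S a) (hy : y ∈ G.cluster S c) (hyc : y ≠ c) :
    G.FreeAC (G.openAt c (Function.update S e true)) a b c := by
  rw [← G.kSwapSealed_kmConfig h hj hk hy hyc]
  refine ⟨(G.o1_kmConfig h hj hk hy hyc).2, fun ω hω ho1 heq => ?_⟩
  have := G.kSwapSealed_injective c b heq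
  subst this
  exact G.not_badM_kmConfig h hj hk hy hyc ⟨⟨hω.1.2.1, hω.1.2.2⟩, hω.2⟩

end LemmaD

end MultiGraph

end PercRepro
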